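import Mathlib.Combinatorics.Additive.ApproximateSubgroup
import Mathlib.Combinatorics.Additive.Energy
import Mathlib.Analysis.SpecialFunctions.Pow.Real

/-!
# Sets with small product set are controlled by an approximate group (Tao 2008, Theorem 4.6)

Topic `Literature/Combinatorics/Additive`.  One NAMED FACT — the discrete case of
T. Tao, *Product set estimates for non-commutative groups*, Combinatorica **28** (2008) 547–594,
arXiv:math/0601431 [Tao2006], **Theorem 4.6** — stated as printed, two PROVED corollaries that
restate its conclusion with Mathlib's `IsApproximateSubgroup`, and (last section) its PROOF
`Tao2006_SmallProductSet_holds`, following §§3–4 of the source (Lemma 4.3, Proposition 4.5, the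
Ruzsa triangle and covering lemmas, and the tripling classification from Mathlib).

## Source and numbering

Numbering: the Combinatorica version numbers all environments by section; in the arXiv text (one
running counter) the items of §4 "Convolution and multiplicative energy" are Definition 17 (= 4.1,
multiplicative energy), Remark 18, Lemma 19, Remark 20, Proposition 21 (= 4.5), **Theorem 22
(= Theorem 4.6)**, Corollaries 23–24 (= 4.7, 4.8); Definition 14 (§3) is the definition of a
`K`-approximate group.  Read from the materialised arXiv text (`lit read arxiv:math/0601431`, p. 9).

* Setup (§2, Example 3 "Discrete case"): `G` an arbitrary group with counting measure; the
  "multiplicative sets" are the finite non-empty subsets; `X ≲ Y` / `X = O(Y)` means `X ≤ C·Y` "for an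
  absolute constant `C` (not depending on the choice of group `G` or on any other parameters)".
* Definition 14 (approximate groups). A multiplicative set `H` is a `K`-approximate group if it is
  symmetric (`H⁻¹ = H`) and there is a finite SYMMETRIC set `X ⊂ H²` of cardinality at most `K` such
  that `H·H ⊆ X·H`.  (No requirement `1 ∈ H`.)
* Theorem 4.6 (= arXiv Theorem 22). Let `K ≥ 1` and let `A, B` be multiplicative sets.  The following
  are equivalent "in the sense that if one of them holds for one choice of implied constant in the
  `O()` and `≲` notation, then the other statement holds for a different choice of implied constant":
  (i) `μ(A·B) ≲ K^{O(1)} μ(A)^{1/2} μ(B)^{1/2}`;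
  (ii) there exists a `O(K^{O(1)})`-approximate group `H` of size `μ(H) ≲ K^{O(1)} μ(A)^{1/2} μ(B)^{1/2}`
  and a finite set `X` of cardinality `O(K^{O(1)})` such that `A ⊂ X·H` and `B ⊂ H·X`.

## What is here

* `Tao2006_SmallProductSet : Prop` — the implication (i) ⇒ (ii) of Theorem 4.6 in the discrete case
  with the hypothesis taken with implied constants `1` (`|A·B| ≤ K |A|^{1/2} |B|^{1/2}`, the form every
  user quotes) and the conclusion's absolute constants packaged as one `C : ℕ` (`O(K^{O(1)})` becomes
  `C·K^C`; one constant for multiplier and exponent is no loss).  The approximate group is Tao's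
  Definition 14 written out: `H` closed under inverses, a cover `X₁` of `H·H` by `|X₁| ≤ C K^C` left
  translates of `H`, with `X₁` symmetric and `X₁ ⊆ H·H`.  Groups are taken in `Type` (universe `0`), as
  in the consumers' files and in `Literature.GroupTheory.ApproximateGroups.BreuillardGreenTao2011_SL2`.
  NAMED FACT (a `def`, D-0014); users take `(h : Tao2006_SmallProductSet)` and are fed
  `Tao2006_SmallProductSet_holds`, the PROOF given in the last section of this file (Ruzsa calculus +
  Proposition 4.5, the multiplicative-energy argument of §§3–4 of the source, with explicit constants
  in `Tao2006_SmallProductSet.exists_approximateGroup_of_small_productSet`).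
* `Tao2006_SmallProductSet.isApproximateSubgroup` — PROVED from the fact: the same conclusion with
  Mathlib's `IsApproximateSubgroup (C K^C) H` (which asks `1 ∈ H`, `H⁻¹ = H` and a cover of `H²` by
  `≤ C K^C` left translates of `H`, with no condition on the covering set).  Bridge: replace `H` by
  `H ∪ {1}` and the cover `X₁` by `X₁ ∪ {1}`; the constant `C` becomes `C + 1`.
* `Tao2006_SmallProductSet.exists_fn` — PROVED: the `∃ f : ℝ → ℝ` packaging of the previous statement
  (the shape asked for by the `MatrixMultiplication` consumers, THEOREM-F input (I4)).

## What is NOT here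

The converse (ii) ⇒ (i) (trivial, not needed), the continuous / Lie-group and metric-entropy versions
(§6 of the source), Theorem 3.9 on tripling as a separate statement (Mathlib has the squaring version
`IsApproximateSubgroup.of_small_tripling`), Proposition 4.5 for general `n` (only `n = 3` is
needed and proved), and any optimisation of the constant (`C = 262144` below is what the printed
argument gives without effort).
-/

namespace Literature.Combinatorics.Additive

open scoped Pointwise

/-- **Tao 2008, Theorem 4.6 (discrete case; = Theorem 22 of arXiv:math/0601431), (i) ⇒ (ii).**
There is an absolute constant `C` such that for every group `G`, every `K ≥ 1` and all finite
non-empty `A, B ⊆ G` with `|A·B| ≤ K·|A|^{1/2}·|B|^{1/2}` there exist finite sets `H, X₁, X ⊆ G` with: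
`H` symmetric (`h ∈ H ⇒ h⁻¹ ∈ H`); `X₁` symmetric, `X₁ ⊆ H·H`, `|X₁| ≤ C·K^C` and `H·H ⊆ X₁·H`
(i.e. `H` is a `C K^C`-approximate group in the sense of Definition 14 of the source);
`|H| ≤ C·K^C·|A|^{1/2}|B|^{1/2}`; `|X| ≤ C·K^C`; `A ⊆ X·H` and `B ⊆ H·X`.
(Source: "implied constants absolute, not depending on the choice of group `G`"; hypothesis (i)
taken with implied constant `1`.)  NAMED FACT (a `def`); PROVED below:
`Tao2006_SmallProductSet_holds`.
[cite: Tao2006, Theorem 4.6] -/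
def Tao2006_SmallProductSet : Prop :=
  ∃ C : ℕ, ∀ (G : Type) [Group G] [DecidableEq G] (K : ℝ), 1 ≤ K →
    ∀ A B : Finset G, A.Nonempty → B.Nonempty →
      ((A * B).card : ℝ) ≤ K * Real.sqrt ((A.card : ℝ) * B.card) →
      ∃ H X₁ X : Finset G,
        (∀ h ∈ H, h⁻¹ ∈ H) ∧
        (∀ x ∈ X₁, x⁻¹ ∈ X₁) ∧ (↑X₁ : Set G) ⊆ ↑H * ↑H ∧ (X₁.card : ℝ) ≤ C * K ^ C ∧
        (↑H * ↑H : Set G) ⊆ ↑X₁ * ↑H ∧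
        (H.card : ℝ) ≤ C * K ^ C * Real.sqrt ((A.card : ℝ) * B.card) ∧
        (X.card : ℝ) ≤ C * K ^ C ∧
        (↑A : Set G) ⊆ ↑X * ↑H ∧ (↑B : Set G) ⊆ ↑H * ↑X

namespace Tao2006_SmallProductSet

/-- `C K^C + 1 ≤ (C+1) K^{C+1}` for `K ≥ 1`; private arithmetic helper. [folklore] -/
private theorem const_step {K : ℝ} (hK : 1 ≤ K) (C : ℕ) :
    (C : ℝ) * K ^ C + 1 ≤ ((C + 1 : ℕ) : ℝ) * K ^ (C + 1) := by
  have hKC : (1 : ℝ) ≤ K ^ C := one_le_pow₀ hK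
  have hKC1 : K ^ C ≤ K ^ (C + 1) := pow_le_pow_right₀ hK (Nat.le_succ C)
  have hC0 : (0 : ℝ) ≤ C := Nat.cast_nonneg C
  push_cast
  nlinarith [mul_le_mul_of_nonneg_left hKC1 hC0]

/-- **Mathlib form of Tao 2008, Theorem 4.6** (consequence of `Tao2006_SmallProductSet`): there is an
absolute `C : ℕ` such that for every group `G`, `K ≥ 1` and finite non-empty `A, B ⊆ G` with
`|A·B| ≤ K |A|^{1/2}|B|^{1/2}` there are finite `H, X ⊆ G` with `IsApproximateSubgroup (C K^C) H`
(Mathlib: `1 ∈ H`, `H⁻¹ = H`, `H²` covered by `≤ C K^C` left translates of `H`),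
`|H| ≤ C K^C |A|^{1/2}|B|^{1/2}`, `|X| ≤ C K^C`, `A ⊆ X·H`, `B ⊆ H·X`.  Bridge from Definition 14 of
the source: `H ∪ {1}` with cover `X₁ ∪ {1}`; constant `C ↦ C + 1`. [cite: Tao2006, Theorem 4.6] -/
theorem isApproximateSubgroup (h : Tao2006_SmallProductSet) :
    ∃ C : ℕ, ∀ (G : Type) [Group G] [DecidableEq G] (K : ℝ), 1 ≤ K →
      ∀ A B : Finset G, A.Nonempty → B.Nonempty →
        ((A * B).card : ℝ) ≤ K * Real.sqrt ((A.card : ℝ) * B.card) →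
        ∃ H X : Finset G,
          IsApproximateSubgroup ((C : ℝ) * K ^ C) (↑H : Set G) ∧
          (H.card : ℝ) ≤ C * K ^ C * Real.sqrt ((A.card : ℝ) * B.card) ∧
          (X.card : ℝ) ≤ C * K ^ C ∧
          (↑A : Set G) ⊆ ↑X * ↑H ∧ (↑B : Set G) ⊆ ↑H * ↑X := by
  obtain ⟨C, hC⟩ := h
  refine ⟨C + 1, ?_⟩
  intro G _ _ K hK A B hA hB hAB
  obtain ⟨H, X₁, X, hHsymm, -, -, hX₁card, hcover, hHcard, hXcard, hAXH, hBHX⟩ :=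
    hC G K hK A B hA hB hAB
  -- the new constant dominates the old one (and the old one plus one)
  have hstep : (C : ℝ) * K ^ C + 1 ≤ ((C + 1 : ℕ) : ℝ) * K ^ (C + 1) := const_step hK C
  have hmono : (C : ℝ) * K ^ C ≤ ((C + 1 : ℕ) : ℝ) * K ^ (C + 1) := by linarith
  -- `s = |A|^{1/2}|B|^{1/2} ≥ 1`
  set s : ℝ := Real.sqrt ((A.card : ℝ) * B.card) with hs
  have hs1 : (1 : ℝ) ≤ s := by
    have hA1 : (1 : ℝ) ≤ A.card := by exact_mod_cast hA.card_pos
    have hB1 : (1 : ℝ) ≤ B.card := by exact_mod_cast hB.card_pos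
    rw [hs, show (1 : ℝ) = Real.sqrt 1 by simp]
    exact Real.sqrt_le_sqrt (by nlinarith)
  -- the approximate group `H' = H ∪ {1}` and its cover `X₁' = X₁ ∪ {1}`
  set H' : Finset G := insert 1 H with hH'
  set X₁' : Finset G := insert 1 X₁ with hX₁'
  have hH'one : (1 : G) ∈ H' := Finset.mem_insert_self _ _
  have hHH' : H ⊆ H' := Finset.subset_insert _ _
  have hH'symm : ∀ z ∈ H', z⁻¹ ∈ H' := by
    intro z hz
    rcases Finset.mem_insert.mp hz with rfl | hz
    · rw [inv_one]; exact hH'one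
    · exact Finset.mem_insert_of_mem (hHsymm z hz)
  have hinv : (↑H' : Set G)⁻¹ = ↑H' := by
    ext z
    rw [Set.mem_inv, Finset.mem_coe, Finset.mem_coe]
    constructor
    · intro hz
      have := hH'symm _ hz
      rwa [inv_inv] at this
    · intro hz
      exact hH'symm _ hz
  have hcover' : (↑H' * ↑H' : Set G) ⊆ ↑X₁' * ↑H' := by
    intro z hz
    obtain ⟨a, ha, b, hb, rfl⟩ := Set.mem_mul.mp hz
    rw [Finset.mem_coe, hH', Finset.mem_insert] at ha hb
    have h1X : (1 : G) ∈ (↑X₁' : Set G) := by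
      rw [Finset.mem_coe, hX₁']; exact Finset.mem_insert_self _ _
    have hXX : (↑X₁ : Set G) ⊆ ↑X₁' := by
      rw [hX₁', Finset.coe_insert]; exact Set.subset_insert _ _
    rcases ha with rfl | ha
    · -- `1 * b = 1 * b` with `1 ∈ X₁'`, `b ∈ H'`
      refine Set.mul_mem_mul h1X ?_
      rw [Finset.mem_coe, hH', Finset.mem_insert]; exact hb
    rcases hb with rfl | hb
    · -- `a * 1 = 1 * a`
      rw [mul_one, ← one_mul a]
      exact Set.mul_mem_mul h1X (by rw [Finset.mem_coe]; exact hHH' ha)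
    · -- `a * b ∈ H * H ⊆ X₁ * H ⊆ X₁' * H'`
      have hab : a * b ∈ (↑H * ↑H : Set G) :=
        Set.mul_mem_mul (Finset.mem_coe.mpr ha) (Finset.mem_coe.mpr hb)
      exact Set.mul_subset_mul hXX (Finset.coe_subset.mpr hHH') (hcover hab)
  have hX₁'card : (X₁'.card : ℝ) ≤ ((C + 1 : ℕ) : ℝ) * K ^ (C + 1) := by
    have h1 : X₁'.card ≤ X₁.card + 1 := Finset.card_insert_le _ _
    have h2 : (X₁'.card : ℝ) ≤ X₁.card + 1 := by exact_mod_cast h1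
    linarith
  refine ⟨H', X, ⟨?_, hinv, ?_⟩, ?_, hXcard.trans hmono, ?_, ?_⟩
  · exact_mod_cast hH'one
  · refine ⟨X₁', hX₁'card, ?_⟩
    rw [sq]
    exact hcover'
  · have h1 : H'.card ≤ H.card + 1 := Finset.card_insert_le _ _
    have h2 : (H'.card : ℝ) ≤ H.card + 1 := by exact_mod_cast h1
    have h3 : (H.card : ℝ) + 1 ≤ (C * K ^ C + 1) * s := by nlinarith
    calc (H'.card : ℝ) ≤ (C * K ^ C + 1) * s := h2.trans h3
      _ ≤ ((C + 1 : ℕ) : ℝ) * K ^ (C + 1) * s :=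
          mul_le_mul_of_nonneg_right hstep (by linarith)
  · exact hAXH.trans (Set.mul_subset_mul_left (Finset.coe_subset.mpr hHH'))
  · exact hBHX.trans (Set.mul_subset_mul_right (Finset.coe_subset.mpr hHH'))

/-- The `∃ f : ℝ → ℝ` packaging of `isApproximateSubgroup` (shape requested by the
`MatrixMultiplication` consumers): one function `f` of `K` bounds the approximate-group parameter,
`|H| / (|A|^{1/2}|B|^{1/2})` and `|X|` simultaneously. [cite: Tao2006, Theorem 4.6] -/
theorem exists_fn (h : Tao2006_SmallProductSet) :
    ∃ f : ℝ → ℝ, ∀ (G : Type) [Group G] [DecidableEq G] (K : ℝ), 1 ≤ K →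
      ∀ A B : Finset G, A.Nonempty → B.Nonempty →
        ((A * B).card : ℝ) ≤ K * Real.sqrt ((A.card : ℝ) * B.card) →
        ∃ H X : Finset G,
          IsApproximateSubgroup (f K) (↑H : Set G) ∧
          (H.card : ℝ) ≤ f K * Real.sqrt ((A.card : ℝ) * B.card) ∧
          (X.card : ℝ) ≤ f K ∧
          (↑A : Set G) ⊆ ↑X * ↑H ∧ (↑B : Set G) ⊆ ↑H * ↑X := by
  obtain ⟨C, hC⟩ := isApproximateSubgroup h
  exact ⟨fun K => (C : ℝ) * K ^ C, hC⟩

end Tao2006_SmallProductSet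

/-! ## Discharge: proof of Theorem 4.6 (i) ⇒ (ii) (Tao 2008, §§3–4)

The printed proof, formalised: the Ruzsa triangle inequality (Lemma 3.2; Mathlib's
`Finset.ruzsa_triangle_inequality_div_div_div`) gives `|A·A⁻¹| ≤ K²|A|`; **Proposition 4.5**
(popular set `S = {x : μ(A ∩ A·x) > μ(A)/2K}`, via **Lemma 4.3** `E(A,A⁻¹) = E(A⁻¹,A)`,
Cauchy–Schwarz, and the double-counting bound `μ(A·S³·A⁻¹) ≤ 8K⁷μ(A)`) is proved below in the
discrete case; the tripling classification (Theorem 3.9 / Corollary 3.10) is Mathlib's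
`Finset.small_pow_of_small_tripling` + `Finset.ruzsa_covering_mul` (Lemma 3.6), which make
`H = S²` an approximate group in the sense of Definition 3.8 (symmetric cover `X₁ = F ∪ F⁻¹ ⊆ H²`);
Ruzsa covering of `A` and `B⁻¹` by translates of `H²` finishes. All constants are explicit
(`exists_approximateGroup_of_small_productSet`); the fact follows with `C = 262144`.
-/

open Finset

namespace Tao2006_SmallProductSet

variable {G : Type*} [Group G] [DecidableEq G]

/-! ### The representation function `r_A(x) = |A ∩ A·x| = #{(u, b) ∈ A⁻¹ × A : u b = x}` -/

/-- `r_A(x) = μ(A ∩ (A · x))`, counted as the pairs `(u, b) ∈ A⁻¹ × A` with `u b = x`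
(`= 1_{A⁻¹} * 1_A (x)`). [cite: Tao2006, Proposition 4.5 (proof)] -/
def rep (A : Finset G) (x : G) : ℕ := #{p ∈ A⁻¹ ×ˢ A | p.1 * p.2 = x}

/-- `r_A(x) ≤ |A|` (a pair `(u, b)` with `u b = x` is determined by `b`).
[cite: Tao2006, Proposition 4.5 (proof: "bounding μ(A ∩ (A·x)) by μ(A)")] -/
theorem rep_le_card (A : Finset G) (x : G) : rep A x ≤ #A := by
  unfold rep
  refine card_le_card_of_injOn Prod.snd (fun p hp => ?_) ?_
  · simp only [coe_filter, Set.mem_setOf_eq, mem_product] at hp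
    exact hp.1.2
  · intro p hp q hq h
    simp only [coe_filter, Set.mem_setOf_eq, mem_product] at hp hq
    have h1 : p.1 = q.1 := by
      have hp2 := hp.2; have hq2 := hq.2
      rw [← hq2, h] at hp2
      exact mul_right_cancel hp2
    exact Prod.ext h1 h

/-- `r_A(1) = |A|`. [cite: Tao2006, Proposition 4.5 (proof)] -/
theorem rep_one (A : Finset G) : rep A 1 = #A := by
  unfold rep
  refine card_nbij' Prod.snd (fun b => (b⁻¹, b)) (fun p hp => ?_) (fun b hb => ?_) (fun p hp => ?_)
    (fun b _ => rfl)
  · simp only [coe_filter, Set.mem_setOf_eq, mem_product] at hp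
    exact hp.1.2
  · simp only [mem_coe] at hb
    simp only [coe_filter, Set.mem_setOf_eq, mem_product, inv_mul_cancel, and_true]
    exact ⟨inv_mem_inv hb, hb⟩
  · simp only [coe_filter, Set.mem_setOf_eq, mem_product] at hp
    have h1 : p.1 = p.2⁻¹ := eq_inv_of_mul_eq_one_left hp.2
    exact Prod.ext h1.symm rfl

/-- `r_A(x⁻¹) = r_A(x)` (so the popular set is symmetric), via `(u, b) ↦ (b⁻¹, u⁻¹)`.
[cite: Tao2006, Proposition 4.5 (proof: "S is a symmetric multiplicative set")] -/
theorem rep_inv (A : Finset G) (x : G) : rep A x⁻¹ = rep A x := by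
  unfold rep
  refine card_nbij' (fun p => (p.2⁻¹, p.1⁻¹)) (fun p => (p.2⁻¹, p.1⁻¹)) (fun p hp => ?_)
    (fun p hp => ?_) (fun p _ => by simp) (fun p _ => by simp)
  · simp only [coe_filter, Set.mem_setOf_eq, mem_product] at hp ⊢
    refine ⟨⟨inv_mem_inv hp.1.2, Finset.mem_inv'.1 hp.1.1⟩, ?_⟩
    rw [← mul_inv_rev, hp.2, inv_inv]
  · simp only [coe_filter, Set.mem_setOf_eq, mem_product] at hp ⊢
    refine ⟨⟨inv_mem_inv hp.1.2, Finset.mem_inv'.1 hp.1.1⟩, ?_⟩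
    rw [← mul_inv_rev, hp.2]

/-- `Σ_x r_A(x) = |A|²` (Fubini). [cite: Tao2006, Proposition 4.5 (proof)] -/
theorem sum_rep (A : Finset G) : ∑ x ∈ A⁻¹ * A, rep A x = #A * #A := by
  unfold rep
  rw [sum_card_fiberwise_eq_card_filter, filter_true_of_mem, card_product, card_inv]
  intro p hp
  rw [mem_product] at hp
  exact mul_mem_mul hp.1 hp.2

/-! ### Lemma 4.3: `E(A, A⁻¹) = E(A⁻¹, A)` -/

/-- **Tao 2008, Lemma 4.3** (= arXiv Lemma 19): for any finite `A` in any group,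
`E(A, A⁻¹) = E(A⁻¹, A)` — the quadruples `a₁ b₁ = a₂ b₂` (`aᵢ ∈ A`, `bᵢ ∈ A⁻¹`) and
`v₁ c₁ = v₂ c₂` (`vᵢ ∈ A⁻¹`, `cᵢ ∈ A`) correspond under `(a₁, a₂, b₁, b₂) ↦ (a₂⁻¹, b₂, a₁, b₁⁻¹)`.
[cite: Tao2006, Lemma 4.3] -/
theorem mulEnergy_inv_comm (A : Finset G) : mulEnergy A A⁻¹ = mulEnergy A⁻¹ A := by
  unfold mulEnergy
  refine card_nbij' (fun z => ((z.1.2⁻¹, z.2.2), (z.1.1, z.2.1⁻¹)))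
    (fun z => ((z.2.1, z.1.1⁻¹), (z.2.2⁻¹, z.1.2))) (fun z hz => ?_) (fun z hz => ?_)
    (fun z _ => by simp) (fun z _ => by simp)
  · simp only [coe_filter, Set.mem_setOf_eq, mem_product] at hz ⊢
    obtain ⟨⟨⟨h11, h12⟩, h21, h22⟩, heq⟩ := hz
    refine ⟨⟨⟨inv_mem_inv h12, h22⟩, h11, Finset.mem_inv'.1 h21⟩, ?_⟩
    -- a₂⁻¹ * a₁ = b₂ * b₁⁻¹
    rw [inv_mul_eq_iff_eq_mul, ← mul_assoc, eq_mul_inv_iff_mul_eq, heq]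
  · simp only [coe_filter, Set.mem_setOf_eq, mem_product] at hz ⊢
    obtain ⟨⟨⟨h11, h12⟩, h21, h22⟩, heq⟩ := hz
    refine ⟨⟨⟨h21, Finset.mem_inv'.1 h11⟩, inv_mem_inv h22, h12⟩, ?_⟩
    -- c₁ * c₂⁻¹ = v₁⁻¹ * v₂  given v₁ c₁ = v₂ c₂
    rw [mul_inv_eq_iff_eq_mul, mul_assoc, eq_inv_mul_iff_mul_eq, heq]

/-- Cauchy–Schwarz + Lemma 4.3: `|A|⁴ ≤ |A · A⁻¹| · Σ_{x ∈ A⁻¹A} r_A(x)²`.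
[cite: Tao2006, Proposition 4.5 (proof, first display)] -/
theorem card_pow_four_le (A : Finset G) :
    #A ^ 2 * #A ^ 2 ≤ #(A * A⁻¹) * ∑ x ∈ A⁻¹ * A, rep A x ^ 2 := by
  have h := le_card_mul_mul_mulEnergy A A⁻¹
  rw [card_inv, mulEnergy_inv_comm, mulEnergy_eq_sum_sq'] at h
  exact h

/-! ### Proposition 4.5: the popular set `S = {x : r_A(x) > |A| / 2K}` -/

/-- Tao's popular set `S := {x ∈ G : μ(A ∩ (A · x)) > μ(A) / 2K}` (it lies inside `A⁻¹ · A`).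
[cite: Tao2006, Proposition 4.5 (proof)] -/
noncomputable def popSet (A : Finset G) (K : ℝ) : Finset G :=
  {x ∈ A⁻¹ * A | (#A : ℝ) < 2 * K * rep A x}

/-- Membership in the popular set. [cite: Tao2006, Proposition 4.5 (proof)] -/
theorem mem_popSet {A : Finset G} {K : ℝ} {x : G} :
    x ∈ popSet A K ↔ x ∈ A⁻¹ * A ∧ (#A : ℝ) < 2 * K * rep A x := by
  unfold popSet; rw [mem_filter]

/-- Elements of the popular set are popular: `|A| < 2K · r_A(x)`.
[cite: Tao2006, Proposition 4.5 (proof)] -/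
theorem lt_rep_of_mem_popSet {A : Finset G} {K : ℝ} {x : G} (hx : x ∈ popSet A K) :
    (#A : ℝ) < 2 * K * rep A x := (mem_popSet.1 hx).2

/-- `1 ∈ S` (as `r_A(1) = |A| > |A|/2K`). [cite: Tao2006, Proposition 4.5] -/
theorem one_mem_popSet {A : Finset G} (hA : A.Nonempty) {K : ℝ} (hK : 1 ≤ K) :
    (1 : G) ∈ popSet A K := by
  rw [mem_popSet, rep_one]
  obtain ⟨a, ha⟩ := hA
  refine ⟨?_, ?_⟩
  · simpa using mul_mem_mul (inv_mem_inv ha) ha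
  · have h0 : (0 : ℝ) < #A := by exact_mod_cast card_pos.2 ⟨a, ha⟩
    nlinarith

/-- `S` is symmetric. [cite: Tao2006, Proposition 4.5] -/
theorem inv_mem_popSet {A : Finset G} {K : ℝ} {x : G} (hx : x ∈ popSet A K) :
    x⁻¹ ∈ popSet A K := by
  rw [mem_popSet] at hx ⊢
  rw [rep_inv]
  refine ⟨?_, hx.2⟩
  obtain ⟨u, hu, b, hb, rfl⟩ := mem_mul.1 hx.1
  rw [mul_inv_rev]
  exact mul_mem_mul (inv_mem_inv hb) (Finset.mem_inv'.1 hu)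

/-- `S⁻¹ = S`. [cite: Tao2006, Proposition 4.5] -/
theorem popSet_inv (A : Finset G) (K : ℝ) : (popSet A K)⁻¹ = popSet A K := by
  ext x
  rw [Finset.mem_inv']
  constructor
  · intro h; simpa using inv_mem_popSet h
  · exact inv_mem_popSet

/-- **Tao 2008, Proposition 4.5, first half**: if `|A · A⁻¹| ≤ K|A|` then `μ(S) ≥ μ(A)/2K`.
[cite: Tao2006, Proposition 4.5] -/
theorem card_le_two_mul_card_popSet {A : Finset G} (hA : A.Nonempty) {K : ℝ} (hK : 0 < K)
    (hAA : (#(A * A⁻¹) : ℝ) ≤ K * #A) : (#A : ℝ) ≤ 2 * K * #(popSet A K) := by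
  set N : ℝ := (#A : ℝ) with hN
  have hN0 : 0 < N := by rw [hN]; exact_mod_cast hA.card_pos
  set S := popSet A K with hS
  -- the energy
  set E : ℕ := ∑ x ∈ A⁻¹ * A, rep A x ^ 2 with hE
  have hE1 : N ^ 2 * N ^ 2 ≤ #(A * A⁻¹) * (E : ℝ) := by
    rw [hN, hE]; exact_mod_cast card_pow_four_le A
  have hE2 : N ^ 2 * N ^ 2 ≤ K * N * E :=
    hE1.trans (mul_le_mul_of_nonneg_right hAA (by positivity))
  -- split the energy along `S`
  have hsplit : (E : ℝ) = ∑ x ∈ (A⁻¹ * A).filter (fun x => (#A : ℝ) < 2 * K * rep A x),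
      ((rep A x : ℕ) : ℝ) ^ 2 + ∑ x ∈ (A⁻¹ * A).filter (fun x => ¬ ((#A : ℝ) < 2 * K * rep A x)),
      ((rep A x : ℕ) : ℝ) ^ 2 := by
    rw [hE, sum_filter_add_sum_filter_not]; push_cast; rfl
  -- popular part: each term ≤ N², and the index set is `S`
  have hpop : ∑ x ∈ (A⁻¹ * A).filter (fun x => (#A : ℝ) < 2 * K * rep A x),
      ((rep A x : ℕ) : ℝ) ^ 2 ≤ #S * N ^ 2 := by
    have : (A⁻¹ * A).filter (fun x => (#A : ℝ) < 2 * K * rep A x) = S := rfl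
    rw [this]
    calc ∑ x ∈ S, ((rep A x : ℕ) : ℝ) ^ 2 ≤ ∑ x ∈ S, N ^ 2 := by
          refine sum_le_sum fun x _ => ?_
          have h1 : ((rep A x : ℕ) : ℝ) ≤ N := by rw [hN]; exact_mod_cast rep_le_card A x
          have h0 : (0 : ℝ) ≤ (rep A x : ℕ) := by positivity
          nlinarith
      _ = #S * N ^ 2 := by rw [sum_const, nsmul_eq_mul]
  -- unpopular part: `r(x)² ≤ r(x) · N / 2K`, and `Σ r = N²`
  have hunpop : ∑ x ∈ (A⁻¹ * A).filter (fun x => ¬ ((#A : ℝ) < 2 * K * rep A x)),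
      ((rep A x : ℕ) : ℝ) ^ 2 ≤ N * N * N / (2 * K) := by
    calc ∑ x ∈ (A⁻¹ * A).filter (fun x => ¬ ((#A : ℝ) < 2 * K * rep A x)),
          ((rep A x : ℕ) : ℝ) ^ 2
        ≤ ∑ x ∈ (A⁻¹ * A).filter (fun x => ¬ ((#A : ℝ) < 2 * K * rep A x)),
          ((rep A x : ℕ) : ℝ) * (N / (2 * K)) := by
          refine sum_le_sum fun x hx => ?_
          have hx' := (mem_filter.1 hx).2
          push Not at hx'
          have h0 : (0 : ℝ) ≤ (rep A x : ℕ) := by positivity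
          have h2 : ((rep A x : ℕ) : ℝ) ≤ N / (2 * K) := by
            rw [le_div_iff₀ (by positivity)]; linarith
          rw [sq]; exact mul_le_mul_of_nonneg_left h2 h0
      _ ≤ ∑ x ∈ A⁻¹ * A, ((rep A x : ℕ) : ℝ) * (N / (2 * K)) :=
          sum_le_sum_of_subset_of_nonneg (filter_subset _ _) fun x _ _ => by positivity
      _ = N * N * N / (2 * K) := by
          rw [← sum_mul]
          have : ∑ x ∈ A⁻¹ * A, ((rep A x : ℕ) : ℝ) = N * N := by
            rw [hN]; exact_mod_cast sum_rep A
          rw [this]; ring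
  have hfinal : N ^ 2 * N ^ 2 ≤ K * N * (#S * N ^ 2 + N * N * N / (2 * K)) := by
    calc N ^ 2 * N ^ 2 ≤ K * N * E := hE2
      _ ≤ K * N * (#S * N ^ 2 + N * N * N / (2 * K)) := by
          rw [hsplit]; exact mul_le_mul_of_nonneg_left (add_le_add hpop hunpop) (by positivity)
  have hK' : K * N * (#S * N ^ 2 + N * N * N / (2 * K)) =
      N ^ 3 * (K * #S) + N ^ 2 * N ^ 2 / 2 := by
    field_simp
  rw [hK'] at hfinal
  have h3 : N ^ 2 * N ^ 2 / 2 ≤ N ^ 3 * (K * #S) := by linarith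
  have h4 : N ^ 3 * N ≤ N ^ 3 * (2 * K * #S) := by nlinarith
  exact le_of_mul_le_mul_left h4 (by positivity)

/-- **Tao 2008, Proposition 4.5, second half** (the case `n = 3` of
`μ(A · Sⁿ · A⁻¹) ≤ 2ⁿ K^{2n+1} μ(A)`): if `|A · A⁻¹| ≤ K|A|` then `|A · S³ · A⁻¹| ≤ 8 K⁷ |A|`.
Double counting: above each `x = a₀ s₁ s₂ s₃ v ∈ A S³ A⁻¹` the product map
`(A A⁻¹)⁴ → G`, `(y₀, y₁, y₂, y₃) ↦ y₀ y₁ y₂ y₃` has at least `r(s₁) r(s₂) r(s₃) > (|A|/2K)³`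
points `(a₀ b₁⁻¹, b₁ s₁ b₂⁻¹, b₂ s₂ b₃⁻¹, b₃ s₃ v)`. [cite: Tao2006, Proposition 4.5] -/
theorem card_mul_popSet_three_mul_inv_le {A : Finset G} (hA : A.Nonempty) {K : ℝ} (hK : 0 < K)
    (hAA : (#(A * A⁻¹) : ℝ) ≤ K * #A) :
    (#(A * (popSet A K * popSet A K * popSet A K) * A⁻¹) : ℝ) ≤ 8 * K ^ 7 * #A := by
  set N : ℝ := (#A : ℝ) with hN
  have hN0 : 0 < N := by rw [hN]; exact_mod_cast hA.card_pos
  set S := popSet A K with hS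
  set T := A * (S * S * S) * A⁻¹ with hT
  set D := A * A⁻¹ with hD
  set Q := D ×ˢ (D ×ˢ (D ×ˢ D)) with hQ
  -- each fibre of the product map over `T` has at least `(N / 2K)³` points
  have hfib : ∀ x ∈ T, (N / (2 * K)) ^ 3 ≤
      (#{y ∈ Q | y.1 * y.2.1 * y.2.2.1 * y.2.2.2 = x} : ℝ) := by
    intro x hx
    rw [hT] at hx
    obtain ⟨w, hw, v, hv, rfl⟩ := mem_mul.1 hx
    obtain ⟨a₀, ha₀, t, ht, rfl⟩ := mem_mul.1 hw
    obtain ⟨t₂, ht₂, s₃, hs₃, rfl⟩ := mem_mul.1 ht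
    obtain ⟨s₁, hs₁, s₂, hs₂, rfl⟩ := mem_mul.1 ht₂
    -- the fibres of `r_A` above `s₁, s₂, s₃` and the injection `Φ`
    set P := {p ∈ A⁻¹ ×ˢ A | p.1 * p.2 = s₁} ×ˢ ({p ∈ A⁻¹ ×ˢ A | p.1 * p.2 = s₂} ×ˢ
      {p ∈ A⁻¹ ×ˢ A | p.1 * p.2 = s₃}) with hP
    have hcardP : (#P : ℝ) = rep A s₁ * (rep A s₂ * rep A s₃) := by
      rw [hP, card_product, card_product]; push_cast; rfl
    set Φ : (G × G) × (G × G) × (G × G) → G × G × G × G := fun q =>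
      (a₀ * q.1.1, (q.1.2 * q.2.1.1, (q.2.1.2 * q.2.2.1, q.2.2.2 * v))) with hΦ
    have hmaps : ∀ q ∈ P,
        Φ q ∈ {y ∈ Q | y.1 * y.2.1 * y.2.2.1 * y.2.2.2 = a₀ * (s₁ * s₂ * s₃) * v} := by
      intro q hq
      simp only [hP, mem_product, mem_filter] at hq
      obtain ⟨⟨⟨h11, h12⟩, e1⟩, ⟨⟨h21, h22⟩, e2⟩, ⟨⟨h31, h32⟩, e3⟩⟩ := hq
      rw [mem_filter, hQ, mem_product, mem_product, mem_product, hD]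
      refine ⟨⟨mul_mem_mul ha₀ h11, mul_mem_mul h12 h21, mul_mem_mul h22 h31,
        mul_mem_mul h32 hv⟩, ?_⟩
      rw [← e1, ← e2, ← e3]
      simp only [hΦ, mul_assoc]
    have hinj : Set.InjOn Φ ↑P := by
      intro q hq q' hq' h
      rw [mem_coe] at hq hq'
      simp only [hP, mem_product, mem_filter] at hq hq'
      obtain ⟨⟨-, e1⟩, ⟨-, e2⟩, ⟨-, e3⟩⟩ := hq
      obtain ⟨⟨-, e1'⟩, ⟨-, e2'⟩, ⟨-, e3'⟩⟩ := hq'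
      simp only [hΦ, Prod.mk.injEq] at h
      obtain ⟨h0, h1, h2, h3⟩ := h
      have c11 : q.1.1 = q'.1.1 := mul_left_cancel h0
      have c12 : q.1.2 = q'.1.2 := by
        rw [← e1', c11] at e1; exact mul_left_cancel e1
      have c21 : q.2.1.1 = q'.2.1.1 := by
        rw [c12] at h1; exact mul_left_cancel h1
      have c22 : q.2.1.2 = q'.2.1.2 := by
        rw [← e2', c21] at e2; exact mul_left_cancel e2
      have c31 : q.2.2.1 = q'.2.2.1 := by
        rw [c22] at h2; exact mul_left_cancel h2
      have c32 : q.2.2.2 = q'.2.2.2 := by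
        rw [← e3', c31] at e3; exact mul_left_cancel e3
      exact Prod.ext (Prod.ext c11 c12) (Prod.ext (Prod.ext c21 c22) (Prod.ext c31 c32))
    have hle := card_le_card_of_injOn Φ hmaps hinj
    have hr : ∀ s ∈ S, N / (2 * K) ≤ rep A s := fun s hs => by
      rw [div_le_iff₀ (by positivity)]
      have := lt_rep_of_mem_popSet hs
      rw [← hN] at this
      linarith
    have h0 : 0 ≤ N / (2 * K) := by positivity
    calc (N / (2 * K)) ^ 3 = (N / (2 * K)) * ((N / (2 * K)) * (N / (2 * K))) := by ring
      _ ≤ rep A s₁ * (rep A s₂ * rep A s₃) :=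
          mul_le_mul (hr s₁ hs₁) (mul_le_mul (hr s₂ hs₂) (hr s₃ hs₃) h0 (by positivity)) (by positivity)
            (by positivity)
      _ = #P := hcardP.symm
      _ ≤ _ := by exact_mod_cast hle
  -- the fibres are disjoint pieces of `Q = (A A⁻¹)⁴`
  have hsum : ∑ x ∈ T, #{y ∈ Q | y.1 * y.2.1 * y.2.2.1 * y.2.2.2 = x} ≤ #Q := by
    rw [sum_card_fiberwise_eq_card_filter]; exact card_filter_le _ _
  have hQcard : (#Q : ℝ) ≤ (K * N) ^ 4 := by
    have hDc : (#D : ℝ) ≤ K * N := by rw [hD, hN]; exact hAA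
    have e : #Q = #D ^ 4 := by rw [hQ, card_product, card_product, card_product]; ring
    rw [e]; push_cast
    exact pow_le_pow_left₀ (by positivity) hDc 4
  have hmain : (#T : ℝ) * (N / (2 * K)) ^ 3 ≤ (K * N) ^ 4 := by
    calc (#T : ℝ) * (N / (2 * K)) ^ 3 = ∑ x ∈ T, (N / (2 * K)) ^ 3 := by
          rw [sum_const, nsmul_eq_mul]
      _ ≤ ∑ x ∈ T, (#{y ∈ Q | y.1 * y.2.1 * y.2.2.1 * y.2.2.2 = x} : ℝ) := sum_le_sum hfib
      _ ≤ #Q := by exact_mod_cast hsum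
      _ ≤ (K * N) ^ 4 := hQcard
  -- conclude
  have hkey : (#T : ℝ) * N ^ 3 ≤ 8 * K ^ 7 * N * N ^ 3 := by
    have e : (#T : ℝ) * (N / (2 * K)) ^ 3 * (8 * K ^ 3) = #T * N ^ 3 := by
      field_simp
      norm_num
    calc (#T : ℝ) * N ^ 3 = (#T : ℝ) * (N / (2 * K)) ^ 3 * (8 * K ^ 3) := e.symm
      _ ≤ (K * N) ^ 4 * (8 * K ^ 3) := mul_le_mul_of_nonneg_right hmain (by positivity)
      _ = 8 * K ^ 7 * N * N ^ 3 := by ring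
  rw [hN] at hkey ⊢
  exact le_of_mul_le_mul_right hkey (by positivity)

/-! ### Theorem 4.6 (i) ⇒ (ii): assembly with explicit constants -/

/-- **Tao 2008, Theorem 4.6, (i) ⇒ (ii), with explicit constants** (finite sets in any group):
if `A, B` are finite non-empty with `|A·B| ≤ K |A|^{1/2}|B|^{1/2}` (`K ≥ 1`) then, with
`S` the popular set of Proposition 4.5 for `A` (parameter `K²`, since `|A·A⁻¹| ≤ K²|A|` by the
Ruzsa triangle inequality) and `H := S·S`: `H` is symmetric, `H·H ⊆ X₁·H` for a symmetric
`X₁ ⊆ H·H` with `|X₁| ≤ 8192 K⁴⁸` (Ruzsa covering applied to `S⁴·S`, small because `S` has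
tripling `≤ 16K¹⁶`), `|H| ≤ 8K¹⁵|A|^{1/2}|B|^{1/2}`, and `A ⊆ X·H`, `B ⊆ H·X` for some `X` with
`|X| ≤ 262144 K⁶⁶` (Ruzsa covering of `A` and of `B⁻¹` by translates of `H·H`).
[cite: Tao2006, Theorem 4.6 (proof), Proposition 4.5, Lemma 3.6 (Ruzsa covering), Corollary 3.10] -/
theorem exists_approximateGroup_of_small_productSet {K : ℝ} (hK : 1 ≤ K) {A B : Finset G}
    (hA : A.Nonempty) (hB : B.Nonempty)
    (hAB : (#(A * B) : ℝ) ≤ K * Real.sqrt ((#A : ℝ) * #B)) :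
    ∃ H X₁ X : Finset G,
      H⁻¹ = H ∧ X₁⁻¹ = X₁ ∧ X₁ ⊆ H * H ∧ (#X₁ : ℝ) ≤ 8192 * K ^ 48 ∧
      H * H ⊆ X₁ * H ∧ (#H : ℝ) ≤ 8 * K ^ 15 * Real.sqrt ((#A : ℝ) * #B) ∧
      (#X : ℝ) ≤ 262144 * K ^ 66 ∧ A ⊆ X * H ∧ B ⊆ H * X := by
  have hK0 : 0 < K := by linarith
  set N : ℝ := (#A : ℝ) with hN
  have hN0 : 0 < N := by rw [hN]; exact_mod_cast hA.card_pos
  have hBpos : (0 : ℝ) < #B := by exact_mod_cast hB.card_pos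
  set s : ℝ := Real.sqrt ((#A : ℝ) * #B) with hs
  have hs0 : 0 ≤ s := Real.sqrt_nonneg _
  -- `|A| ≤ K s` and `s ≤ K |A|`
  have hAB' : (#(A * B) : ℝ) * #(A * B) ≤ K ^ 2 * N * #B := by
    have h := pow_le_pow_left₀ (by positivity) hAB 2
    rw [mul_pow, hs, Real.sq_sqrt (by positivity), ← hN] at h
    nlinarith [h]
  have hA_le : N ≤ K * s := by
    have : (#A : ℝ) ≤ #(A * B) := by exact_mod_cast card_le_card_mul_right hB
    rw [hN]; exact this.trans hAB
  have hs_le : s ≤ K * N := by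
    have hB_le : (#B : ℝ) ≤ K * s := by
      have : (#B : ℝ) ≤ #(A * B) := by exact_mod_cast card_le_card_mul_left hA
      exact this.trans hAB
    have hss : s * s = N * #B := by rw [hs, hN, Real.mul_self_sqrt (by positivity)]
    by_cases hs00 : s = 0
    · rw [hs00]; positivity
    have hspos : 0 < s := lt_of_le_of_ne hs0 (Ne.symm hs00)
    have : s * s ≤ s * (K * N) := by
      rw [hss]
      calc N * (#B : ℝ) ≤ N * (K * s) := mul_le_mul_of_nonneg_left hB_le hN0.le
        _ = s * (K * N) := by ring
    exact le_of_mul_le_mul_left this hspos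
  -- (a) Ruzsa triangle inequality: `|A·A⁻¹| ≤ K² |A|`
  have hAA : (#(A * A⁻¹) : ℝ) ≤ K ^ 2 * #A := by
    have h := ruzsa_triangle_inequality_div_div_div A B⁻¹ A
    rw [div_inv_eq_mul, card_inv, div_eq_mul_inv] at h
    have h' : (#(A * A⁻¹) : ℝ) * #B ≤ #(A * B) * #(A * B) := by exact_mod_cast h
    rw [← hN]
    exact le_of_mul_le_mul_right (h'.trans (hAB'.trans_eq (by ring))) hBpos
  set K₂ : ℝ := K ^ 2 with hK₂
  have hK₂1 : 1 ≤ K₂ := by rw [hK₂]; nlinarith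
  have hK₂0 : 0 < K₂ := by positivity
  have hAA2 : (#(A * A⁻¹) : ℝ) ≤ K₂ * #A := hAA
  -- (b) the popular set `S` of Proposition 4.5
  set S := popSet A K₂ with hSdef
  have h1S : (1 : G) ∈ S := one_mem_popSet hA hK₂1
  have hSsymm : S⁻¹ = S := popSet_inv A K₂
  have hSne : S.Nonempty := ⟨1, h1S⟩
  have hAS : N ≤ 2 * K₂ * #S := card_le_two_mul_card_popSet hA hK₂0 hAA2
  have hT : (#(A * (S * S * S) * A⁻¹) : ℝ) ≤ 8 * K₂ ^ 7 * N :=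
    card_mul_popSet_three_mul_inv_le hA hK₂0 hAA2
  -- (c) `S` has small tripling
  set K' : ℝ := 16 * K₂ ^ 8 with hK'
  have hS3' : (#(S * S * S) : ℝ) ≤ 8 * K₂ ^ 7 * N := by
    have h1 : #(S * S * S) ≤ #(A * (S * S * S)) := card_le_card_mul_left hA
    have h2 : #(A * (S * S * S)) ≤ #(A * (S * S * S) * A⁻¹) := card_le_card_mul_right hA.inv
    exact le_trans (by exact_mod_cast h1.trans h2) hT
  have hS3 : (#(S ^ 3) : ℝ) ≤ K' * #S := by
    rw [show S ^ 3 = S * S * S by rw [pow_succ, sq]]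
    calc (#(S * S * S) : ℝ) ≤ 8 * K₂ ^ 7 * N := hS3'
      _ ≤ 8 * K₂ ^ 7 * (2 * K₂ * #S) := by gcongr
      _ = K' * #S := by rw [hK']; ring
  -- (d) `H = S²`; Ruzsa covering of `H² = S⁴` by translates of `S / S = H`
  set H := S * S with hHdef
  have hHsymm : H⁻¹ = H := by rw [hHdef, mul_inv_rev, hSsymm]
  have hHinv : ∀ g ∈ H, g⁻¹ ∈ H := fun g hg => by rw [← hHsymm]; exact inv_mem_inv hg
  have hSH : S ⊆ H := by rw [hHdef]; exact subset_mul_left S h1S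
  have h1H : (1 : G) ∈ H := hSH h1S
  have hHne : H.Nonempty := ⟨1, h1H⟩
  have hHS3 : H ⊆ S * S * S := by rw [hHdef]; exact subset_mul_left _ h1S
  have hHcard : (#H : ℝ) ≤ 8 * K₂ ^ 7 * N :=
    le_trans (by exact_mod_cast card_le_card hHS3) hS3'
  have hScardH : (#S : ℝ) ≤ #H := by exact_mod_cast card_le_card hSH
  have hS5 : (#(S ^ 4 * S) : ℝ) ≤ K' ^ 3 * #S := by
    have h := small_pow_of_small_tripling (m := 5) (by norm_num) hS3 hSsymm
    have e : S ^ 4 * S = S ^ 5 := (pow_succ S 4).symm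
    rw [e]
    exact h
  obtain ⟨F, hFS4, hFcard, hS4F⟩ := ruzsa_covering_mul hSne hS5
  have hSdivS : S / S = H := by rw [div_eq_mul_inv, hSsymm, hHdef]
  have hS4 : S ^ 4 = H * H := by
    rw [show (4 : ℕ) = 2 + 2 from rfl, pow_add, sq, hHdef]
  rw [hSdivS, hS4] at hS4F
  rw [hS4] at hFS4
  set X₁ := F ∪ F⁻¹ with hX₁
  have hX₁symm : X₁⁻¹ = X₁ := by
    ext x
    simp only [hX₁, Finset.mem_inv', mem_union, inv_inv]
    exact or_comm
  have hX₁inv : ∀ g ∈ X₁, g⁻¹ ∈ X₁ := fun g hg => by rw [← hX₁symm]; exact inv_mem_inv hg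
  have hX₁HH : X₁ ⊆ H * H := by
    rw [hX₁]
    refine union_subset hFS4 ?_
    have e : (H * H)⁻¹ = H * H := by rw [mul_inv_rev, hHsymm]
    rw [← e]
    exact inv_subset_inv hFS4
  have hX₁card : (#X₁ : ℝ) ≤ 2 * K' ^ 3 := by
    have h1 : #X₁ ≤ #F + #F⁻¹ := card_union_le _ _
    rw [card_inv] at h1
    have h2 : (#X₁ : ℝ) ≤ #F + #F := by exact_mod_cast h1
    linarith
  have hHHX₁ : H * H ⊆ X₁ * H := hS4F.trans (mul_subset_mul_right subset_union_left)
  -- (e) cover `A` by translates of `H`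
  have hAH : (#(A * H) : ℝ) ≤ K' * #H := by
    have h1 : A * H ⊆ A * (S * S * S) := mul_subset_mul_left hHS3
    have h2 : #(A * (S * S * S)) ≤ #(A * (S * S * S) * A⁻¹) := card_le_card_mul_right hA.inv
    calc (#(A * H) : ℝ) ≤ #(A * (S * S * S) * A⁻¹) := by
          exact_mod_cast (card_le_card h1).trans h2
      _ ≤ 8 * K₂ ^ 7 * N := hT
      _ ≤ 8 * K₂ ^ 7 * (2 * K₂ * #S) := by gcongr
      _ ≤ 8 * K₂ ^ 7 * (2 * K₂ * #H) := by gcongr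
      _ = K' * #H := by rw [hK']; ring
  obtain ⟨Z, -, hZcard, hAZ⟩ := ruzsa_covering_mul hHne hAH
  have hHdivH : H / H = H * H := by rw [div_eq_mul_inv, hHsymm]
  rw [hHdivH] at hAZ
  have hAcov : A ⊆ Z * X₁ * H :=
    calc A ⊆ Z * (H * H) := hAZ
      _ ⊆ Z * (X₁ * H) := mul_subset_mul_left hHHX₁
      _ = Z * X₁ * H := (mul_assoc _ _ _).symm
  -- (f) cover `B⁻¹` by translates of `H` (Ruzsa triangle: `|B⁻¹ H| |A| ≤ |A B| |A H|`)
  have hBH : (#(B⁻¹ * H) : ℝ) ≤ K ^ 2 * K' * #H := by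
    have h := ruzsa_triangle_inequality_div_div_div B⁻¹ A H⁻¹
    rw [div_inv_eq_mul, div_eq_mul_inv, div_eq_mul_inv, ← mul_inv_rev, ← mul_inv_rev, card_inv,
      card_inv] at h
    have h' : (#(B⁻¹ * H) : ℝ) * N ≤ #(A * B) * #(A * H) := by rw [hN]; exact_mod_cast h
    have h'' : (#(B⁻¹ * H) : ℝ) * N ≤ (K ^ 2 * K' * #H) * N :=
      calc (#(B⁻¹ * H) : ℝ) * N ≤ #(A * B) * #(A * H) := h'
        _ ≤ (K * s) * (K' * #H) := mul_le_mul hAB hAH (by positivity) (by positivity)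
        _ ≤ (K * (K * N)) * (K' * #H) := by gcongr
        _ = (K ^ 2 * K' * #H) * N := by ring
    exact le_of_mul_le_mul_right h'' hN0
  obtain ⟨W, -, hWcard, hBW⟩ := ruzsa_covering_mul hHne hBH
  rw [hHdivH] at hBW
  have hBcov : B ⊆ H * (X₁ * W⁻¹) := by
    intro b hb
    have hb' : b⁻¹ ∈ W * (X₁ * H) := (hBW.trans (mul_subset_mul_left hHHX₁)) (inv_mem_inv hb)
    obtain ⟨w, hw, z, hz, hwz⟩ := mem_mul.1 hb'
    obtain ⟨x, hx, h, hh, rfl⟩ := mem_mul.1 hz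
    have hb_eq : b = (w * (x * h))⁻¹ := by rw [hwz, inv_inv]
    rw [hb_eq]
    simp only [mul_inv_rev, mul_assoc]
    exact mul_mem_mul (hHinv h hh) (mul_mem_mul (hX₁inv x hx) (inv_mem_inv hw))
  -- (g) assemble
  refine ⟨H, X₁, Z * X₁ ∪ X₁ * W⁻¹, hHsymm, hX₁symm, hX₁HH, ?_, hHHX₁, ?_, ?_, ?_, ?_⟩
  · calc (#X₁ : ℝ) ≤ 2 * K' ^ 3 := hX₁card
      _ = 8192 * K ^ 48 := by rw [hK', hK₂]; ring
  · calc (#H : ℝ) ≤ 8 * K₂ ^ 7 * N := hHcard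
      _ ≤ 8 * K₂ ^ 7 * (K * s) := by gcongr
      _ = 8 * K ^ 15 * s := by rw [hK₂]; ring
  · have h1 : (#(Z * X₁) : ℝ) ≤ K' * (2 * K' ^ 3) :=
      calc (#(Z * X₁) : ℝ) ≤ #Z * #X₁ := by exact_mod_cast card_mul_le
        _ ≤ K' * (2 * K' ^ 3) := mul_le_mul hZcard hX₁card (by positivity) (by positivity)
    have h2 : (#(X₁ * W⁻¹) : ℝ) ≤ (2 * K' ^ 3) * (K ^ 2 * K') :=
      calc (#(X₁ * W⁻¹) : ℝ) ≤ #X₁ * #W⁻¹ := by exact_mod_cast card_mul_le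
        _ = #X₁ * #W := by rw [card_inv]
        _ ≤ (2 * K' ^ 3) * (K ^ 2 * K') := mul_le_mul hX₁card hWcard (by positivity) (by positivity)
    have h3 : (#(Z * X₁ ∪ X₁ * W⁻¹) : ℝ) ≤ #(Z * X₁) + #(X₁ * W⁻¹) := by
      exact_mod_cast card_union_le _ _
    have hK1' : (1 : ℝ) ≤ K ^ 2 := by nlinarith
    calc (#(Z * X₁ ∪ X₁ * W⁻¹) : ℝ) ≤ K' * (2 * K' ^ 3) + (2 * K' ^ 3) * (K ^ 2 * K') :=
          h3.trans (add_le_add h1 h2)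
      _ ≤ K ^ 2 * (K' * (2 * K' ^ 3)) + (2 * K' ^ 3) * (K ^ 2 * K') :=
          add_le_add (le_mul_of_one_le_left (by positivity : (0 : ℝ) ≤ K' * (2 * K' ^ 3)) hK1')
            le_rfl
      _ = 262144 * K ^ 66 := by rw [hK', hK₂]; ring
  · exact hAcov.trans (mul_subset_mul_right subset_union_left)
  · exact hBcov.trans (mul_subset_mul_left subset_union_right)

end Tao2006_SmallProductSet

/-- **Discharge of `Tao2006_SmallProductSet`** (Tao 2008, Theorem 4.6, (i) ⇒ (ii), discrete
case), following the printed proof: Ruzsa triangle inequality (`|A·A⁻¹| ≤ K²|A|`), the popular set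
`S` of Proposition 4.5 (`|S| ≥ |A|/2K²`, `|A·S³·A⁻¹| ≤ 8K¹⁴|A|`, hence `S` symmetric with tripling
`≤ 16K¹⁶`), the tripling classification (Mathlib's `Finset.small_pow_of_small_tripling` and
`Finset.ruzsa_covering_mul` make `H = S²` an approximate group in the sense of Definition 3.8 of the
source), and Ruzsa covering of `A` and `B⁻¹` by translates of `H`; absolute constant `C = 262144`.
[cite: Tao2006, Theorem 4.6] -/
theorem Tao2006_SmallProductSet_holds : Tao2006_SmallProductSet := by
  refine ⟨262144, ?_⟩
  intro G _ _ K hK A B hA hB hAB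
  obtain ⟨H, X₁, X, hHsymm, hX₁symm, hX₁HH, hX₁card, hHHX₁, hHcard, hXcard, hAcov, hBcov⟩ :=
    Tao2006_SmallProductSet.exists_approximateGroup_of_small_productSet hK hA hB hAB
  have hK48 : K ^ 48 ≤ K ^ 262144 := pow_le_pow_right₀ hK (by norm_num)
  have hK15 : K ^ 15 ≤ K ^ 262144 := pow_le_pow_right₀ hK (by norm_num)
  have hK66 : K ^ 66 ≤ K ^ 262144 := pow_le_pow_right₀ hK (by norm_num)
  have hKC : (0 : ℝ) ≤ K ^ 262144 := by positivity
  have hs : (0 : ℝ) ≤ Real.sqrt ((#A : ℝ) * #B) := Real.sqrt_nonneg _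
  refine ⟨H, X₁, X, fun h hh => ?_, fun x hx => ?_, ?_, ?_, ?_, ?_, ?_, ?_, ?_⟩
  · rw [← hHsymm]; exact Finset.inv_mem_inv hh
  · rw [← hX₁symm]; exact Finset.inv_mem_inv hx
  · rw [← Finset.coe_mul]; exact Finset.coe_subset.2 hX₁HH
  · push_cast
    nlinarith [mul_le_mul_of_nonneg_left hK48 (by norm_num : (0 : ℝ) ≤ 8192)]
  · rw [← Finset.coe_mul, ← Finset.coe_mul]; exact Finset.coe_subset.2 hHHX₁
  · push_cast
    calc (#H : ℝ) ≤ 8 * K ^ 15 * Real.sqrt ((#A : ℝ) * #B) := hHcard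
      _ ≤ 262144 * K ^ 262144 * Real.sqrt ((#A : ℝ) * #B) := by
          refine mul_le_mul_of_nonneg_right ?_ hs
          nlinarith [mul_le_mul_of_nonneg_left hK15 (by norm_num : (0 : ℝ) ≤ 8)]
  · push_cast
    nlinarith [mul_le_mul_of_nonneg_left hK66 (by norm_num : (0 : ℝ) ≤ 262144)]
  · rw [← Finset.coe_mul]; exact Finset.coe_subset.2 hAcov
  · rw [← Finset.coe_mul]; exact Finset.coe_subset.2 hBcov

end Literature.Combinatorics.Additive
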